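import Literature.MathematicalPhysics.QuantumLattice.GrassmannLaplacianTruncatedBound
import Literature.MathematicalPhysics.QuantumLattice.GrassmannVertexPositionsProtected
import HarnessLib

/-!
# One deletion pattern of one script with PRESCRIBED output legs: the label sums

Topic `Literature/MathematicalPhysics/QuantumLattice`; the label-restricted twin of the one-pattern estimate
`GrassmannLaplacianTruncatedBound.sum_kerProd_sum_patWeight_le` (Benfatto–Giuliani–Mastropietro 2006, proof of (2.77), with the
sectorised bookkeeping of §2.4, Lemma 2.6 and (2.84)–(2.90); Gawȩdzki–Kupiainen 1985, §3).  There one output label `W_i` is pinned and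
the other output labels are summed freely, each kernel vertex entering through its anchored `L¹–L^∞` norm `N_u` (ANY one leg pinned).
Here a set `J` of further output slots (`i ∉ J`) is summed only over labels satisfying prescribed predicates `A j` (in the application:
prescribed sectors).  In a deletion pattern every output slot `j` is a definite field position, hence a definite leg of a definite input
vertex, so the prescription becomes a constraint on `F_u(π)` legs of the vertex `u`; that vertex is then estimated by its anchored norm
with those legs constrained AND one further leg pinned — the leg through which the spanning tree enters it (or the pinned output leg, for
the root), which is never one of the prescribed external legs: the positions of the derivative steps of a pattern are distinct and are
avoided by its Laplacian steps, so they may be protected (`GrassmannVertexPositionsProtected.sum_kerProd_mul_lapWt_le_of_pinnable`).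

* (private) `mem_patSet_cons`, `mem_of_mem_patSet`, `pairwise_of_mem_patSet` — in a pattern of `patSet ops S` every step sits
  inside `S` and every later step avoids the first position of every earlier step; `sum_filter_patWeight_map_ext_le_prescribed` — the
  constrained output-label sum of the derivative steps, `Σ_W weight(Z, ∂_W, π) ≤ [Z_{p_i} = w] ∏_{j∈J} [A_j(Z_{p_j})]`;
* **`sum_kerProd_sum_patWeight_le_prescribed`** — `Σ_Y ∏‖K‖ Σ_{W : W_i = w, A_j(W_j)} weight ≤ [π admissible] (α/2)^k ∏_u N_u(F_u(π))`,
  the vertices entering through the two-parameter family `N_u(F)` (anchored norm with `F` further legs constrained).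

Everything is proved; no named fact.

## Sources

G. Benfatto, A. Giuliani, V. Mastropietro, Ann. Henri Poincaré 7 (2006) 809–898, proof of (2.77), §2.4 Lemma 2.6, (2.84)–(2.90)
(`BenfattoGiulianiMastropietro2006`); K. Gawȩdzki, A. Kupiainen, Comm. Math. Phys. 102 (1985) 1–30, §3 (`GawedzkiKupiainen1985GrossNeveu`).
-/

noncomputable section

namespace Literature.MathematicalPhysics.QuantumLattice

open GrassmannAlgebra Finset
open Literature.Probability.LatticeModels Literature.Probability.LatticeModels.BattleFederbush

/-! ### Patterns: the steps stay inside the position set, later steps avoid earlier first positions -/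

section Patterns

variable {𝕜 : Type*} {Γ : Type*} {N : ℕ}

/-- Membership in the patterns of `o :: ops`: a step of `o`, then a pattern of `ops` on the remaining positions. [folklore] -/
private theorem mem_patSet_cons {o : DelOp Γ 𝕜} {ops : List (DelOp Γ 𝕜)} {S : Finset (Fin N)} {π : List (Fin N × Fin N)} :
    π ∈ patSet (o :: ops) S ↔ ∃ pq π', π = pq :: π' ∧ pq ∈ DelOp.stepSet S o ∧ π' ∈ patSet ops (DelOp.rest S o pq) := by
  rw [patSet, mem_map]
  constructor
  · rintro ⟨⟨pq, π'⟩, h, rfl⟩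
    exact ⟨pq, π', rfl, (mem_sigma.1 h).1, (mem_sigma.1 h).2⟩
  · rintro ⟨pq, π', rfl, h1, h2⟩
    exact ⟨⟨pq, π'⟩, mem_sigma.2 ⟨h1, h2⟩, rfl⟩

/-- A step of an operation on `S` sits inside `S`. [folklore] -/
private theorem DelOp.mem_of_mem_stepSet (S : Finset (Fin N)) : ∀ (o : DelOp Γ 𝕜) {pq : Fin N × Fin N},
    pq ∈ DelOp.stepSet S o → pq.1 ∈ S ∧ pq.2 ∈ S
  | DelOp.ext _, _, h => mem_product.1 (mem_filter.1 h).1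
  | DelOp.lap _, _, h => mem_product.1 (mem_filter.1 h).1

/-- The remaining positions are among the old ones. [folklore] -/
private theorem DelOp.rest_subset (S : Finset (Fin N)) : ∀ (o : DelOp Γ 𝕜) (pq : Fin N × Fin N), DelOp.rest S o pq ⊆ S
  | DelOp.ext _, _ => erase_subset _ _
  | DelOp.lap _, _ => (erase_subset _ _).trans (erase_subset _ _)

/-- The first position of a step is deleted. [folklore] -/
private theorem DelOp.fst_not_mem_rest (S : Finset (Fin N)) : ∀ (o : DelOp Γ 𝕜) (pq : Fin N × Fin N), pq.1 ∉ DelOp.rest S o pq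
  | DelOp.ext _, _ => notMem_erase _ _
  | DelOp.lap _, pq => fun h => notMem_erase pq.1 S (mem_of_mem_erase h)

/-- Every step of a pattern on `S` sits inside `S`. [folklore] -/
private theorem mem_of_mem_patSet : ∀ (ops : List (DelOp Γ 𝕜)) (S : Finset (Fin N)) {π : List (Fin N × Fin N)},
    π ∈ patSet ops S → ∀ pq ∈ π, pq.1 ∈ S ∧ pq.2 ∈ S
  | [], S, π, h, pq, hpq => by
    rw [patSet, mem_singleton] at h
    subst h
    exact absurd hpq List.not_mem_nil
  | o :: ops, S, π, h, pq, hpq => by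
    obtain ⟨pq₀, π', rfl, h0, h'⟩ := mem_patSet_cons.1 h
    rcases List.mem_cons.1 hpq with rfl | hpq'
    · exact DelOp.mem_of_mem_stepSet S o h0
    · have h'' := mem_of_mem_patSet ops _ h' pq hpq'
      exact ⟨DelOp.rest_subset S o pq₀ h''.1, DelOp.rest_subset S o pq₀ h''.2⟩

/-- In a pattern, every later step avoids the first position of every earlier step. [folklore] -/
private theorem pairwise_of_mem_patSet : ∀ (ops : List (DelOp Γ 𝕜)) (S : Finset (Fin N)) {π : List (Fin N × Fin N)},
    π ∈ patSet ops S → π.Pairwise fun pq pq' => pq'.1 ≠ pq.1 ∧ pq'.2 ≠ pq.1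
  | [], S, π, h => by
    rw [patSet, mem_singleton] at h
    subst h
    exact List.Pairwise.nil
  | o :: ops, S, π, h => by
    obtain ⟨pq₀, π', rfl, h0, h'⟩ := mem_patSet_cons.1 h
    refine List.pairwise_cons.2 ⟨fun pq' hpq' => ?_, pairwise_of_mem_patSet ops _ h'⟩
    have hm := mem_of_mem_patSet ops _ h' pq' hpq'
    exact ⟨fun he => DelOp.fst_not_mem_rest S o pq₀ (he ▸ hm.1), fun he => DelOp.fst_not_mem_rest S o pq₀ (he ▸ hm.2)⟩

end Patterns

/-! ### One pattern with prescribed output slots -/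

variable {𝕜 : Type*} [RCLike 𝕜] {Γ : Type*} [Fintype Γ] [DecidableEq Γ] {n : ℕ}
variable (C : Matrix Γ Γ 𝕜) (cl : Γ → Fin n) {deg : Fin n → ℕ} (K : ∀ v : Fin n, (Fin (deg v) → Γ) → 𝕜)

/-- **The constrained output-label sum of the derivative steps**: with `W_i = w` and `A_j(W_j)` for `j ∈ J`,
`Σ_W weight(Z, ∂_W, π) ≤ [Z_{p_i} = w] ∏_{j∈J} [A_j(Z_{p_j})]`. [folklore] -/
private theorem sum_filter_patWeight_map_ext_le_prescribed {N : ℕ} (Z : Fin N → Γ) {r : ℕ} (i : Fin r) (w : Γ)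
    (J : Finset (Fin r)) (A : Fin r → Γ → Bool) (π : List (Fin N × Fin N)) (hr : r ≤ π.length) :
    ∑ W ∈ univ.filter (fun W : Fin r → Γ => W i = w ∧ ∀ j ∈ J, A j (W j) = true),
        patWeight Z ((List.ofFn W).map DelOp.ext : List (DelOp Γ 𝕜)) π ≤
      (if Z (π[(i : ℕ)]'(lt_of_lt_of_le i.2 hr)).1 = w then (1 : ℝ) else 0) *
        ∏ j ∈ J, (if A j (Z (π[(j : ℕ)]'(lt_of_lt_of_le j.2 hr)).1) = true then (1 : ℝ) else 0) := by
  set z : Fin r → Γ := fun j => Z (π[(j : ℕ)]'(lt_of_lt_of_le j.2 hr)).1 with hz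
  have hsome : ∀ j : Fin r, (π[(j : ℕ)]?).map (fun pq => Z pq.1) = some (z j) := fun j => by
    rw [List.getElem?_eq_getElem (lt_of_lt_of_le j.2 hr), Option.map_some]
  have hprod : ∀ W : Fin r → Γ, patWeight Z ((List.ofFn W).map DelOp.ext : List (DelOp Γ 𝕜)) π = if z = W then 1 else 0 := by
    intro W
    rw [patWeight_map_ext, prod_boole]
    simp only [hsome, Option.some.injEq, mem_univ, true_implies]
    exact if_congr funext_iff.symm rfl rfl
  simp only [hprod]
  rw [sum_ite_eq]
  have h0 : (0 : ℝ) ≤ (if z i = w then (1 : ℝ) else 0) * ∏ j ∈ J, (if A j (z j) = true then (1 : ℝ) else 0) :=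
    mul_nonneg (by split_ifs <;> norm_num) (prod_nonneg fun j _ => by split_ifs <;> norm_num)
  by_cases hmem : z ∈ univ.filter (fun W : Fin r → Γ => W i = w ∧ ∀ j ∈ J, A j (W j) = true)
  · rw [if_pos hmem]
    obtain ⟨hi, hJ⟩ := (mem_filter.1 hmem).2
    rw [if_pos (show Z (π[(i : ℕ)]'(lt_of_lt_of_le i.2 hr)).1 = w from hi), one_mul,
      prod_eq_one fun j hj => if_pos (show A j (Z (π[(j : ℕ)]'(lt_of_lt_of_le j.2 hr)).1) = true from hJ j hj)]
  · rw [if_neg hmem]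
    exact h0

/-- **The label sum of one pattern of one script with prescribed output slots** (output slot `i` pinned at `w`, slots `j ∈ J`
constrained to `A j`, tree rooted at `cl w`; Benfatto–Giuliani–Mastropietro 2006, proof of (2.77) with the sector bookkeeping of
Lemma 2.6): the constrained slots landing in the vertex `u` number `F_u(π)`, and `u` enters through its anchored norm with those legs
constrained and one further leg pinned, `Σ_Y ∏‖K‖ Σ_W weight ≤ [π admissible] (α/2)^k ∏_u N_u(F_u(π))`.
[cite: BenfattoGiulianiMastropietro2006, proof of (2.77) and Lemma 2.6] -/
theorem sum_kerProd_sum_patWeight_le_prescribed (hK : ∀ v Yv, K v Yv ≠ 0 → ∀ j, cl (Yv j) = v)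
    {r : ℕ} (J : Finset (Fin r)) (A : Fin r → Γ → Bool) (Nv : Fin n → ℕ → ℝ) (hN0 : ∀ u F, 0 ≤ Nv u F)
    (hN : ∀ (u : Fin n) (T : Finset (Fin r)), T ⊆ J → ∀ (ι : T → Fin (deg u)), Function.Injective ι →
      ∀ (t : Fin (deg u)), (∀ j, ι j ≠ t) → ∀ a : Γ,
        ∑ Yu ∈ univ.filter (fun Yu : Fin (deg u) → Γ => Yu t = a),
          ‖K u Yu‖ * ∏ j : T, (if A j (Yu (ι j)) = true then (1 : ℝ) else 0) ≤ Nv u T.card)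
    {α : ℝ} (hα : 0 ≤ α) (hrow : ∀ ℓ X, ∑ Y, ‖typeRestrict C cl ℓ X Y‖ ≤ α) (hcol : ∀ ℓ Y, ∑ X, ‖typeRestrict C cl ℓ X Y‖ ≤ α)
    {w : Γ} {k : ℕ} (s : Script (cl w) k) (hs : s.Valid) (hcov : univ.image s.y = univ) (i : Fin r) (hi : i ∉ J)
    {W₀ : Fin r → Γ} {π : List (Fin (∑ v, deg v) × Fin (∑ v, deg v))} (hπ : π ∈ patSet (scriptOps C cl W₀ s) univ) :
    ∑ Ys : (∀ v, Fin (deg v) → Γ), (∏ u, ‖K u (Ys u)‖) *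
        ∑ W ∈ univ.filter (fun W : Fin r → Γ => W i = w ∧ ∀ j ∈ J, A j (W j) = true), patWeight (flat Ys) (scriptOps C cl W s) π ≤
      (if stepsOK (List.replicate r (fun _ => true) ++ s.lines.reverse.map (lapPred deg)) π then 1 else 0) *
        ((α / 2) ^ k * ∏ u, Nv u (J.filter fun j : Fin r => ((π[(j : ℕ)]?).map fun pq => vert deg pq.1) = some u).card) := by
  classical
  set prof : Fin n → ℕ := fun u => (J.filter fun j : Fin r => ((π[(j : ℕ)]?).map fun pq => vert deg pq.1) = some u).card with hprof
  set D := (α / 2) ^ k * ∏ u, Nv u (prof u) with hD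
  have hD0 : 0 ≤ D := mul_nonneg (pow_nonneg (by positivity) _) (prod_nonneg fun u _ => hN0 u _)
  have hRHS0 : 0 ≤ (if stepsOK (List.replicate r (fun _ => true) ++ s.lines.reverse.map (lapPred deg)) π then (1 : ℝ) else 0) * D := by
    split_ifs <;> simp [hD0]
  set laps : List (DelOp Γ 𝕜) := s.lines.reverse.map fun ℓ => DelOp.lap (typeRestrict C cl ℓ) with hlaps
  have hG0 : ∀ Ys : ∀ v, Fin (deg v) → Γ, 0 ≤ ∏ u, ‖K u (Ys u)‖ := fun Ys => prod_nonneg fun u _ => norm_nonneg _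
  -- the weights factorise: derivative steps (read on the full pattern) times Laplacian steps
  have h1 : ∀ (Ys : ∀ v, Fin (deg v) → Γ) (W : Fin r → Γ), patWeight (flat Ys) (scriptOps C cl W s) π =
      patWeight (flat Ys) ((List.ofFn W).map DelOp.ext : List (DelOp Γ 𝕜)) π * patWeight (flat Ys) laps (π.drop r) := by
    intro Ys W
    rw [scriptOps, patWeight_append, List.length_map, List.length_ofFn]
    congr 1
    rw [patWeight_map_ext, patWeight_map_ext]
    refine prod_congr rfl fun j _ => ?_
    rw [List.getElem?_take_of_lt j.2]
  -- too short patterns carry no weight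
  by_cases hr : π.length < r
  · refine le_trans (le_of_eq (sum_eq_zero fun Ys _ => ?_)) hRHS0
    rw [sum_eq_zero fun W _ => ?_, mul_zero]
    rw [h1, patWeight_map_ext_eq_zero_of_lt _ W _ hr, zero_mul]
  have hr' : r ≤ π.length := not_lt.1 hr
  -- the positions of the derivative steps; distinct, and avoided by the Laplacian steps
  set pos : Fin r → Fin (∑ v, deg v) := fun j => (π[(j : ℕ)]'(lt_of_lt_of_le j.2 hr')).1 with hpos
  have hpw := pairwise_of_mem_patSet _ _ hπ
  rw [List.pairwise_iff_getElem] at hpw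
  have hdist : ∀ j j' : Fin r, j ≠ j' → pos j ≠ pos j' := by
    intro j j' hne
    rcases lt_or_gt_of_ne (Fin.val_ne_of_ne hne) with hlt | hlt
    · exact (hpw j j' (lt_of_lt_of_le j.2 hr') (lt_of_lt_of_le j'.2 hr') hlt).1.symm
    · exact (hpw j' j (lt_of_lt_of_le j'.2 hr') (lt_of_lt_of_le j.2 hr') hlt).1
  have hlap : ∀ pq ∈ π.drop r, ∀ j : Fin r, pq.1 ≠ pos j ∧ pq.2 ≠ pos j := by
    intro pq hpq j
    obtain ⟨m, hm, rfl⟩ := List.mem_iff_getElem.1 hpq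
    rw [List.getElem_drop]
    rw [List.length_drop] at hm
    exact hpw j (r + m) (lt_of_lt_of_le j.2 hr') (by omega) (by omega)
  -- the constrained slots landing in each vertex, and their local legs
  set T : Fin n → Finset (Fin r) := fun u => J.filter fun j : Fin r => vert deg (pos j) = u with hT
  have hTJ : ∀ u, T u ⊆ J := fun u => filter_subset _ _
  have hTv : ∀ u, ∀ j ∈ T u, vert deg (pos j) = u := fun u j hj => (mem_filter.1 hj).2
  have hprofT : ∀ u, prof u = (T u).card := by
    intro u
    refine congrArg card (filter_congr fun j _ => ?_)
    rw [List.getElem?_eq_getElem (lt_of_lt_of_le j.2 hr'), Option.map_some, Option.some.injEq]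
  set ι : ∀ u, ↥(T u) → Fin (deg u) := fun u j => (exists_eq_blockEmb deg (hTv u j j.2)).choose with hι
  have hιspec : ∀ u (j : T u), blockEmb deg u (ι u j) = pos j := fun u j => (exists_eq_blockEmb deg (hTv u j j.2)).choose_spec.symm
  have hιinj : ∀ u, Function.Injective (ι u) := by
    intro u j j' h
    by_contra hne
    have h' := congrArg (blockEmb deg u) h
    rw [hιspec, hιspec] at h'
    exact hdist j j' (fun he => hne (Subtype.ext he)) h'
  -- the restricted kernels
  set K' : ∀ v : Fin n, (Fin (deg v) → Γ) → 𝕜 := fun u Yu =>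
    K u Yu * ∏ j : T u, (if A j (Yu (ι u j)) = true then (1 : 𝕜) else 0) with hK'
  have hK'supp : ∀ v Yv, K' v Yv ≠ 0 → ∀ j, cl (Yv j) = v := fun v Yv h => hK v Yv (left_ne_zero_of_mul h)
  have hnormK' : ∀ u (Yu : Fin (deg u) → Γ), ‖K' u Yu‖ = ‖K u Yu‖ * ∏ j : T u, (if A j (Yu (ι u j)) = true then (1 : ℝ) else 0) := by
    intro u Yu
    rw [hK', norm_mul, norm_prod]
    congr 1
    refine prod_congr rfl fun j _ => ?_
    split_ifs <;> simp
  have hkerK' : ∀ x : Fin (∑ v, deg v) → Γ,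
      kerProd K' x = kerProd K x * ∏ j ∈ J, (if A j (x (pos j)) = true then (1 : ℝ) else 0) := by
    intro x
    rw [kerProd, kerProd]
    simp only [hnormK']
    rw [prod_mul_distrib]
    congr 1
    rw [← prod_fiberwise J (fun j => vert deg (pos j)) fun j => (if A j (x (pos j)) = true then (1 : ℝ) else 0)]
    refine prod_congr rfl fun u _ => ?_
    rw [← prod_coe_sort (T u)]
    refine prod_congr rfl fun j _ => ?_
    rw [hιspec]
  -- pinnable positions: not the position of a constrained derivative step
  set Pn : Fin (∑ v, deg v) → Prop := fun p => ∀ j ∈ J, pos j ≠ p with hPn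
  have hPi : Pn (pos i) := fun j hj => hdist j i (fun he => hi (he ▸ hj))
  have hPlap : ∀ pq ∈ π.drop r, Pn pq.1 ∧ Pn pq.2 :=
    fun pq hpq => ⟨fun j _ => ((hlap pq hpq j).1).symm, fun j _ => ((hlap pq hpq j).2).symm⟩
  have hN' : ∀ u (t : Fin (deg u)), Pn (blockEmb deg u t) → ∀ a : Γ,
      ∑ Yu ∈ univ.filter (fun Yu : Fin (deg u) → Γ => Yu t = a), ‖K' u Yu‖ ≤ Nv u (prof u) := by
    intro u t ht a
    rw [hprofT u]
    simp only [hnormK']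
    refine hN u (T u) (hTJ u) (ι u) (hιinj u) t (fun j he => ht j (hTJ u j.2) ?_) a
    rw [← hιspec u j, he]
  -- the output-label sum
  have h2 : ∀ Ys : ∀ v, Fin (deg v) → Γ, (∏ u, ‖K u (Ys u)‖) *
      ∑ W ∈ univ.filter (fun W : Fin r → Γ => W i = w ∧ ∀ j ∈ J, A j (W j) = true), patWeight (flat Ys) (scriptOps C cl W s) π ≤
      (∏ u, ‖K u (Ys u)‖) * (((if flat Ys (pos i) = w then (1 : ℝ) else 0) *
        ∏ j ∈ J, (if A j (flat Ys (pos j)) = true then (1 : ℝ) else 0)) * patWeight (flat Ys) laps (π.drop r)) := by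
    intro Ys
    refine mul_le_mul_of_nonneg_left ?_ (hG0 Ys)
    simp only [h1]
    rw [← sum_mul]
    exact mul_le_mul_of_nonneg_right (sum_filter_patWeight_map_ext_le_prescribed (𝕜 := 𝕜) (flat Ys) i w J A π hr')
      (patWeight_nonneg _ _ _)
  refine (sum_le_sum fun Ys _ => h2 Ys).trans ?_
  -- reindex by position labellings, pass to the restricted kernels, insert the consistency constraints
  have h3 : ∑ Ys : (∀ v, Fin (deg v) → Γ), (∏ u, ‖K u (Ys u)‖) * (((if flat Ys (pos i) = w then (1 : ℝ) else 0) *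
        ∏ j ∈ J, (if A j (flat Ys (pos j)) = true then (1 : ℝ) else 0)) * patWeight (flat Ys) laps (π.drop r)) =
      ∑ x : Fin (∑ v, deg v) → Γ, if vert deg (pos i) = cl w then
        (if x (pos i) = w then kerProd K' x * lapWt C cl deg s.lines.reverse (π.drop r) x else 0) else 0 := by
    refine Fintype.sum_equiv (flatEquiv deg) _ _ fun Ys => ?_
    rw [flatEquiv_apply, ← kerProd_flat]
    have hx : kerProd K (flat Ys) * (((if flat Ys (pos i) = w then (1 : ℝ) else 0) *
        ∏ j ∈ J, (if A j (flat Ys (pos j)) = true then (1 : ℝ) else 0)) * patWeight (flat Ys) laps (π.drop r)) =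
        (kerProd K' (flat Ys) * patWeight (flat Ys) laps (π.drop r)) * (if flat Ys (pos i) = w then (1 : ℝ) else 0) := by
      rw [hkerK']; ring
    rw [hx, kerProd_mul_patWeight_laps C cl K' hK'supp, mul_assoc, mul_comm (lapWt _ _ _ _ _ _), ← mul_assoc,
      kerProd_mul_ite_eq cl K' hK'supp]
    split_ifs <;> ring
  rw [h3]
  by_cases hv : vert deg (pos i) = cl w
  swap
  · simp only [hv, if_false, sum_const_zero]; exact hRHS0
  simp only [hv, if_true]
  rw [← sum_filter]
  by_cases hc : stepsOK (s.lines.reverse.map (lapPred deg)) (π.drop r) = true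
  · rw [stepsOK_append, List.length_replicate, stepsOK_replicate_true, hc, Bool.and_true,
      if_pos (by rw [decide_eq_true_iff, List.length_take, min_eq_left hr']), one_mul]
    exact sum_kerProd_mul_lapWt_le_of_pinnable C cl K' Pn (fun u => Nv u (prof u)) (fun u => hN0 u _) hN' hα hrow hcol s hs hcov
      (π.drop r) hPlap (pos i) hv hPi w
  · refine le_trans (le_of_eq (sum_eq_zero fun x _ => ?_)) hRHS0
    rw [lapWt_eq C cl x _ _ (List.nodup_reverse.2 (Script.nodup_lines s hs)), if_neg hc, mul_zero]

end Literature.MathematicalPhysics.QuantumLattice
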